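import Summits.ValiantsHypothesis.ValiantsHypothesis.Theorems.LacunarySymmetroidMatrixDescartesCensusDoorA34SheetWindowGram
import Summits.ValiantsHypothesis.ValiantsHypothesis.Theorems.LacunarySymmetroidMatrixDescartesCensusDoorA34SheetWindowGramPeeling

/-!
# `MatrixDescartes` census — DOOR A at `(3,4)`: the two PEELING STEPS of the 2 × 2 orientation law — `E₄ < 0` for the four-root five-nomial and
# `det Q > 0` for the five-root six-nomial (window supports)

HONEST FRAMING.  Object-search cell `pub-symmetroid`, engine seat `val-sym-eng-2` (g10); helper row beside the registered strata line
`Cruxes/DoorA34/Lines/strata.lean` on stmt-ValiantsHypothesis-19980 (`DoorA34 = PosRootLawAt 3 4 18`: OPEN, typed, never asserted here), completing the kernel route of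
report HOME/DOOR-A34-ENG2G10-REPORT.md §6(h) up to the final assembly.  With …SheetWindowGram (realisability square; degenerate Gram ⇒ ≤ 4 roots) and
…SheetWindowGramPeeling (generalized Vandermonde non-vanishing and POSITIVITY in every size; ray-sign; padded five-nomial) this file proves the SIGN statements
of the «peeling» route, for WINDOW supports `0 < d₁`, `2d₁ < d₂` (cofactor convention: variable node LAST, columns sorted):

* `natDegree_leadingCoeff_sum_C_mul_X_pow` — degree / leading coefficient of `Σ C(aₗ)X^{eₗ}` with increasing exponents;
* **`peel_E4_neg`** — nodes `0 < r₁ < r₂ < r₃ < z`, `D_j = det[rows (r₁,r₂,r₃,z), columns E′∖{e_j}]`, `E′ = (0,d₁,2d₁,d₂,d₁+d₂)`: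
  `D₁D₃D₄ − D₀D₄² − D₂D₃² < 0` (as a polynomial in `z`: degree `3(d₁+d₂)`, leading coefficient minus a product of positive `3 × 3` generalized Vandermondes; no
  zero beyond `r₃` by the padded-five-nomial lemma; ray-sign);
* **`peel_gramDet_pos`** — nodes `0 < r₁ < … < r₄ < y`, `D'_j = det[rows (r₁..r₄,y), columns E∖{e_j}]`, `E = (0,d₁,2d₁,d₂,d₁+d₂,2d₂)`:
  `D'₀D'₂D'₅ − D'₁D'₃D'₄/4 + D'₀D'₄²/4 + D'₂D'₃²/4 − D'₅D'₁²/4 > 0` — the GRAM DETERMINANT OF THE FIVE-ROOT INTERPOLANT `c_j = (−1)^{5+j}D'_j` IS POSITIVE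
  (degree `6d₂` in `y`, leading coefficient `−E₄/4 > 0` by `peel_E4_neg`; no zero beyond `r₄` by `card_posRoots_le_four_of_gram_det_eq_zero`; ray-sign).
  This is the kernel form of the located Veronese-sign fact `det Q_f = (1/4)·Π brackets > 0` (report §6(b)) — the value of the constant is not needed.

What remains for the ORIENTATION LAW itself is the assembly (report §6(h) item D): a pencil determinant with five positive roots is a positive multiple of the
interpolant (kernel of the 5 × 6 node matrix + realisability `polarGram_det_eq_sq_div_four`), whence `det G₀ < 0`, `det G₁ < 0`, `det G₂ > 0`.
Nothing here is located; nothing bounds the sheet; `DoorA34` and the three stubs stay OPEN; registers unchanged (`ζ_sym(3,4) ∈ {18,19}`); nothing on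
`MatrixDescartes` (stmt-ValiantsHypothesis-18050) or on `VP ≠ VNP` — VP≠VNP not moved.  [folklore] degree/leading-coefficient bookkeeping, Laplace expansion.
-/

-- `Summit.ValiantsHypothesis.ValiantsHypothesis.…` repeats a component by the D-0017 layout
-- (single-conjunct summit), which the `dupNamespace` linter flags; the name is mandated.
set_option linter.dupNamespace false

namespace Summit.ValiantsHypothesis.ValiantsHypothesis.Theorems.LacunarySymmetroidMatrixDescartes.Census

open scoped BigOperators Matrix
open Polynomial Finset

/-- Degree and leading coefficient of `Σₗ C(aₗ)·X^{eₗ}` with strictly increasing exponents and non-zero top coefficient. [folklore] -/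
theorem natDegree_leadingCoeff_sum_C_mul_X_pow {k : ℕ} (a : Fin (k + 2) → ℝ) (e : Fin (k + 2) → ℕ) (he : StrictMono e)
    (ha : a (Fin.last (k + 1)) ≠ 0) :
    (∑ l, C (a l) * X ^ e l).degree = (e (Fin.last (k + 1)) : WithBot ℕ)
      ∧ (∑ l, C (a l) * X ^ e l).leadingCoeff = a (Fin.last (k + 1)) := by
  have hsplit : (∑ l, C (a l) * X ^ e l) = (∑ j : Fin (k + 1), C (a (Fin.castSucc j)) * X ^ e (Fin.castSucc j))
      + C (a (Fin.last (k + 1))) * X ^ e (Fin.last (k + 1)) := by rw [Fin.sum_univ_castSucc]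
  have hdeg_top : (C (a (Fin.last (k + 1))) * X ^ e (Fin.last (k + 1))).degree = (e (Fin.last (k + 1)) : WithBot ℕ) :=
    degree_C_mul_X_pow _ ha
  have hdeg_rest : (∑ j : Fin (k + 1), C (a (Fin.castSucc j)) * X ^ e (Fin.castSucc j)).degree < (e (Fin.last (k + 1)) : WithBot ℕ) := by
    refine (degree_sum_le _ _).trans_lt ?_
    refine (Finset.sup_lt_iff (WithBot.bot_lt_coe _)).2 fun j _ => ?_
    refine (degree_C_mul_X_pow_le _ _).trans_lt ?_
    exact_mod_cast he (Fin.castSucc_lt_last j)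
  refine ⟨?_, ?_⟩
  · rw [hsplit, degree_add_eq_right_of_degree_lt (hdeg_rest.trans_le hdeg_top.ge), hdeg_top]
  · rw [hsplit, leadingCoeff_add_of_degree_lt (hdeg_rest.trans_le hdeg_top.ge), leadingCoeff_C_mul_X_pow]

/-- **PEELING STEP 4 → 3 (`E₄ < 0`)**: for a window support (`0 < d₁`, `2d₁ < d₂`) and nodes `0 < r₁ < r₂ < r₃ < z`, the `4 × 4` minors
`D_j = det[rows (r₁,r₂,r₃,z), columns E′∖{e_j}]`, `E′ = (0, d₁, 2d₁, d₂, d₁+d₂)`, satisfy `D₁D₃D₄ − D₀D₄² − D₂D₃² < 0` — i.e. for the four-root interpolant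
`g_j = (−1)^{4+j}D_j` on `E′`: `g₁g₃g₄ − g₀g₄² − g₂g₃² < 0`.  (As a polynomial in `z`: degree `3(d₁+d₂)` from `−D₂D₃²`, leading coefficient minus a product of three
positive `3 × 3` generalized Vandermondes; no zero beyond `r₃` by the padded-five-nomial lemma; ray-sign.) [folklore] -/
theorem peel_E4_neg (d₁ d₂ : ℕ) (hd₁ : 0 < d₁) (hw : 2 * d₁ < d₂) (r₁ r₂ r₃ z : ℝ) (h₁ : 0 < r₁) (h₁₂ : r₁ < r₂) (h₂₃ : r₂ < r₃) (h₃ : r₃ < z)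
    (D : Fin 5 → ℝ)
    (hD : ∀ j : Fin 5, D j = (Matrix.of fun (i : Fin 4) (l : Fin 4) =>
        (![r₁, r₂, r₃, z] : Fin 4 → ℝ) i ^ (![0, d₁, 2 * d₁, d₂, d₁ + d₂] : Fin 5 → ℕ) (j.succAbove l)).det) :
    D 1 * D 3 * D 4 - D 0 * D 4 ^ 2 - D 2 * D 3 ^ 2 < 0 := by
  classical
  set E : Fin 5 → ℕ := ![0, d₁, 2 * d₁, d₂, d₁ + d₂] with hE
  set R : Fin 3 → ℝ := ![r₁, r₂, r₃] with hR
  have hEmono : StrictMono E := by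
    refine Fin.strictMono_iff_lt_succ.2 fun i => ?_
    fin_cases i <;> simp [hE] <;> omega
  have hRmono : StrictMono R := by
    refine Fin.strictMono_iff_lt_succ.2 fun i => ?_
    fin_cases i <;> simp [hR] <;> assumption
  have hR0 : 0 < R 0 := by simp [hR]; exact h₁
  have hsnoc : ∀ w : ℝ, (Fin.snoc R w : Fin 4 → ℝ) = ![r₁, r₂, r₃, w] := by
    intro w; ext i; fin_cases i <;> rfl
  set a : Fin 5 → Fin 4 → ℝ := fun j l => (-1) ^ ((2 + 1) + (l : ℕ)) *
      (Matrix.of fun (i : Fin 3) (m : Fin 3) => R i ^ E (j.succAbove (l.succAbove m))).det with ha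
  set P : Fin 5 → ℝ[X] := fun j => ∑ l : Fin 4, C (a j l) * X ^ E (j.succAbove l) with hP
  have hPeval : ∀ j (w : ℝ), (P j).eval w = (Matrix.of fun (i : Fin 4) (l : Fin 4) =>
        (![r₁, r₂, r₃, w] : Fin 4 → ℝ) i ^ E (j.succAbove l)).det := by
    intro j w
    rw [← hsnoc w, genVandermonde_det_eq_eval R (fun l => E (j.succAbove l)) w]
  have hDP : ∀ j, D j = (P j).eval z := fun j => by rw [hD j, hPeval]
  have htop : ∀ j, 0 < a j (Fin.last 3) := by
    intro j
    rw [ha]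
    simp only [Fin.val_last, Fin.succAbove_last]
    rw [show (2 + 1 + 3 : ℕ) = 2 * 3 by norm_num, pow_mul, neg_one_sq, one_pow, one_mul]
    exact genVandermonde_det_pos 2 R (fun m => E (j.succAbove (Fin.castSucc m))) hRmono hR0
      (hEmono.comp ((Fin.strictMono_succAbove j).comp (Fin.strictMono_castSucc)))
  have hdeglc : ∀ j, (P j).degree = (E (j.succAbove (Fin.last 3)) : WithBot ℕ) ∧ (P j).leadingCoeff = a j (Fin.last 3) := fun j =>
    natDegree_leadingCoeff_sum_C_mul_X_pow (a j) (fun l => E (j.succAbove l)) (hEmono.comp (Fin.strictMono_succAbove j)) (htop j).ne'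
  have hPne : ∀ j, P j ≠ 0 := fun j h => by have := (hdeglc j).2; rw [h, leadingCoeff_zero] at this; exact (htop j).ne' this.symm
  have htopE : ∀ j : Fin 5, E (j.succAbove (Fin.last 3)) = if j = 4 then d₂ else d₁ + d₂ := by
    intro j; fin_cases j <;> rfl
  have hnat : ∀ j : Fin 5, (P j).natDegree = if j = 4 then d₂ else d₁ + d₂ := by
    intro j; rw [← htopE j]; exact natDegree_eq_of_degree_eq_some (hdeglc j).1
  set Q : ℝ[X] := P 1 * P 3 * P 4 - P 0 * P 4 ^ 2 - P 2 * P 3 ^ 2 with hQ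
  have hQeval : Q.eval z = D 1 * D 3 * D 4 - D 0 * D 4 ^ 2 - D 2 * D 3 ^ 2 := by
    simp only [hQ, eval_sub, eval_mul, eval_pow, hDP]
  have hA : (P 2 * P 3 ^ 2).natDegree = 3 * (d₁ + d₂) ∧ (P 2 * P 3 ^ 2).leadingCoeff = a 2 (Fin.last 3) * a 3 (Fin.last 3) ^ 2 := by
    constructor
    · rw [natDegree_mul (hPne 2) (pow_ne_zero 2 (hPne 3)), natDegree_pow, hnat 2, hnat 3]; simp; ring
    · rw [leadingCoeff_mul, leadingCoeff_pow, (hdeglc 2).2, (hdeglc 3).2]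
  have hB : (P 1 * P 3 * P 4 - P 0 * P 4 ^ 2).natDegree < 3 * (d₁ + d₂) := by
    refine (natDegree_sub_le _ _).trans_lt (max_lt ?_ ?_)
    · refine (natDegree_mul_le).trans_lt ?_
      refine (Nat.add_le_add natDegree_mul_le le_rfl).trans_lt ?_
      rw [hnat 1, hnat 3, hnat 4]; simp; omega
    · refine (natDegree_mul_le).trans_lt ?_
      refine (Nat.add_le_add le_rfl natDegree_pow_le).trans_lt ?_
      rw [hnat 0, hnat 4]; simp; omega
  have hAne : P 2 * P 3 ^ 2 ≠ 0 := mul_ne_zero (hPne 2) (pow_ne_zero 2 (hPne 3))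
  have hQsplit : Q = -(P 2 * P 3 ^ 2) + (P 1 * P 3 * P 4 - P 0 * P 4 ^ 2) := by rw [hQ]; ring
  have hdegB_lt : (P 1 * P 3 * P 4 - P 0 * P 4 ^ 2).degree < (-(P 2 * P 3 ^ 2)).degree := by
    rw [degree_neg, degree_eq_natDegree hAne, hA.1]
    exact (degree_le_natDegree).trans_lt (by exact_mod_cast hB)
  have hQlc : Q.leadingCoeff = -(a 2 (Fin.last 3) * a 3 (Fin.last 3) ^ 2) := by
    rw [hQsplit, leadingCoeff_add_of_degree_lt' hdegB_lt, leadingCoeff_neg, hA.2]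
  have hQdeg : Q.degree = ((3 * (d₁ + d₂) : ℕ) : WithBot ℕ) := by
    rw [hQsplit, degree_add_eq_left_of_degree_lt hdegB_lt, degree_neg, degree_eq_natDegree hAne, hA.1]
  have hQdegpos : 0 < Q.degree := by rw [hQdeg]; exact_mod_cast (show 0 < 3 * (d₁ + d₂) by omega)
  have hQlcneg : Q.leadingCoeff < 0 := by
    rw [hQlc]; have := mul_pos (htop 2) (pow_pos (htop 3) 2); linarith
  have hno : ∀ w, r₃ < w → Q.eval w ≠ 0 := by
    intro w hw0 hQw
    set c : Fin 5 → ℝ := fun j => (-1) ^ ((3 + 1) + (j : ℕ)) * (P j).eval w with hc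
    have hcoefP : ∀ j, (P j).eval w = (Matrix.of fun (i : Fin 4) (l : Fin 4) => (![r₁, r₂, r₃, w] : Fin 4 → ℝ) i ^ E (j.succAbove l)).det :=
      fun j => hPeval j w
    set G : ℝ[X] := ∑ j : Fin 5, C (c j) * X ^ E j with hG
    have hGeval : ∀ t, G.eval t = (Matrix.of fun (i : Fin 5) (j : Fin 5) => (Fin.snoc (![r₁, r₂, r₃, w] : Fin 4 → ℝ) t : Fin 5 → ℝ) i ^ E j).det := by
      intro t
      rw [genVandermonde_det_eq_eval (![r₁, r₂, r₃, w]) E t, hG]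
      simp only [hc, hcoefP]
    have hGroot : ∀ t, (t = r₁ ∨ t = r₂ ∨ t = r₃ ∨ t = w) → G.eval t = 0 := by
      intro t ht
      rw [hGeval]
      rcases ht with rfl | rfl | rfl | rfl
      · exact Matrix.det_zero_of_row_eq (i := 0) (j := 4) (by decide) (by ext l; simp [Fin.snoc])
      · exact Matrix.det_zero_of_row_eq (i := 1) (j := 4) (by decide) (by ext l; simp [Fin.snoc])
      · exact Matrix.det_zero_of_row_eq (i := 2) (j := 4) (by decide) (by ext l; simp [Fin.snoc])
      · exact Matrix.det_zero_of_row_eq (i := 3) (j := 4) (by decide) (by ext l; simp [Fin.snoc])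
    have v3 : ((3 : Fin 5) : ℕ) = 3 := rfl
    have v4 : ((4 : Fin 5) : ℕ) = 4 := rfl
    have hc4 : c 4 ≠ 0 := by
      rw [hc]
      simp only [v4]
      rw [show (3 + 1 + 4 : ℕ) = 2 * 4 by norm_num, pow_mul, neg_one_sq, one_pow, one_mul, hcoefP]
      refine genVandermonde_det_ne_zero _ _ ?_ ?_ (hEmono.comp (Fin.strictMono_succAbove 4)).injective
      · have hm : StrictMono (![r₁, r₂, r₃, w] : Fin 4 → ℝ) := by
          refine Fin.strictMono_iff_lt_succ.2 fun i => ?_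
          fin_cases i <;> simp <;> linarith
        exact hm.injective
      · intro i; fin_cases i <;> simp <;> linarith
    have hGne : G ≠ 0 := by
      intro h0
      have : G.coeff (E 4) = c 4 := by
        rw [hG, finsetSum_coeff, Finset.sum_eq_single (4 : Fin 5)]
        · rw [coeff_C_mul, coeff_X_pow, if_pos rfl, mul_one]
        · intro j _ hj; rw [coeff_C_mul, coeff_X_pow, if_neg (fun h => hj (hEmono.injective h).symm), mul_zero]
        · intro h; exact absurd (Finset.mem_univ _) h
      rw [h0, coeff_zero] at this; exact hc4 this.symm
    have hfour : 4 ≤ (G.roots.toFinset.filter (fun t => 0 < t)).card := by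
      have hsub : ({r₁, r₂, r₃, w} : Finset ℝ) ⊆ G.roots.toFinset.filter (fun t => 0 < t) := by
        intro t ht
        simp only [Finset.mem_insert, Finset.mem_singleton] at ht
        rw [Finset.mem_filter, Multiset.mem_toFinset, mem_roots hGne, IsRoot.def]
        refine ⟨hGroot t ht, ?_⟩
        rcases ht with rfl | rfl | rfl | rfl <;> linarith
      have hcard : ({r₁, r₂, r₃, w} : Finset ℝ).card = 4 := by
        rw [Finset.card_insert_of_notMem, Finset.card_insert_of_notMem, Finset.card_insert_of_notMem, Finset.card_singleton]
        · simp only [Finset.mem_singleton]; linarith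
        · simp only [Finset.mem_insert, Finset.mem_singleton, not_or]; constructor <;> linarith
        · simp only [Finset.mem_insert, Finset.mem_singleton, not_or]; refine ⟨?_, ?_, ?_⟩ <;> linarith
      exact hcard ▸ Finset.card_le_card hsub
    have hpad : (!![c 0, c 1 / 2, c 3 / 2; c 1 / 2, c 2, c 4 / 2; c 3 / 2, c 4 / 2, 0] : Matrix (Fin 3) (Fin 3) ℝ).det = 0 := by
      have hq : (P 1).eval w * (P 3).eval w * (P 4).eval w - (P 0).eval w * (P 4).eval w ^ 2 - (P 2).eval w * (P 3).eval w ^ 2 = 0 := by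
        have := hQw; simp only [hQ, eval_sub, eval_mul, eval_pow] at this; exact this
      simp only [Matrix.det_fin_three, Matrix.of_apply, Matrix.cons_val', Matrix.cons_val_zero, Matrix.cons_val_one, Matrix.cons_val_two,
        Matrix.empty_val', Matrix.cons_val_fin_one, Matrix.head_cons, Matrix.tail_cons, Matrix.head_fin_const, hc]
      simp only [Fin.val_zero, Fin.val_one, Fin.val_two, v3, v4]
      norm_num
      linear_combination (1 / 4 : ℝ) * hq
    have hGform : G = C (c 0) * X ^ 0 + C (c 1) * X ^ d₁ + C (c 2) * X ^ (2 * d₁) + C (c 3) * X ^ d₂ + C (c 4) * X ^ (d₁ + d₂) := by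
      rw [hG, Fin.sum_univ_five]; simp [hE]
    have hthree := card_posRoots_le_three_of_padded_gram_det_eq_zero d₁ d₂ (c 0) (c 1) (c 2) (c 3) (c 4) hpad (by rw [← hGform]; exact hGne)
    rw [← hGform] at hthree
    omega
  have := leadingCoeff_mul_eval_pos_of_no_roots_beyond Q hQdegpos r₃ hno z h₃
  rw [hQeval] at this
  nlinarith [hQlcneg, this]

/-- Top coefficient of a product of two polynomials with prescribed degree bounds. -/
private theorem coeff_mul_top {f g : ℝ[X]} {m n : ℕ} (hf : f.natDegree ≤ m) (hg : g.natDegree ≤ n) :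
    (f * g).coeff (m + n) = f.coeff m * g.coeff n := coeff_mul_add_eq_of_natDegree_le hf hg

/-- **PEELING STEP 5 → 4 (`det Q > 0`)**: for a window support (`0 < d₁`, `2d₁ < d₂`) and nodes `0 < r₁ < r₂ < r₃ < r₄ < y`, the `5 × 5` minors
`D'_j = det[rows (r₁,…,r₄,y), columns E∖{e_j}]`, `E = (0, d₁, 2d₁, d₂, d₁+d₂, 2d₂)`, satisfy
`D'₀D'₂D'₅ − D'₁D'₃D'₄/4 + D'₀D'₄²/4 + D'₂D'₃²/4 − D'₅D'₁²/4 > 0` — i.e. the Gram determinant of the five-root interpolant `c_j = (−1)^{5+j}D'_j` is POSITIVE.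
(As a polynomial in `y`: degree `6d₂`, leading coefficient `−E₄/4 > 0` by `peel_E4_neg`; no zero beyond `r₄` by `card_posRoots_le_four_of_gram_det_eq_zero`; ray-sign.)
[folklore] -/
theorem peel_gramDet_pos (d₁ d₂ : ℕ) (hd₁ : 0 < d₁) (hw : 2 * d₁ < d₂) (r₁ r₂ r₃ r₄ y : ℝ) (h₁ : 0 < r₁) (h₁₂ : r₁ < r₂) (h₂₃ : r₂ < r₃)
    (h₃₄ : r₃ < r₄) (h₄ : r₄ < y) (D : Fin 6 → ℝ)
    (hD : ∀ j : Fin 6, D j = (Matrix.of fun (i : Fin 5) (l : Fin 5) =>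
        (![r₁, r₂, r₃, r₄, y] : Fin 5 → ℝ) i ^ (![0, d₁, 2 * d₁, d₂, d₁ + d₂, 2 * d₂] : Fin 6 → ℕ) (j.succAbove l)).det) :
    0 < D 0 * D 2 * D 5 - D 1 * D 3 * D 4 / 4 + D 0 * D 4 ^ 2 / 4 + D 2 * D 3 ^ 2 / 4 - D 5 * D 1 ^ 2 / 4 := by
  classical
  set E : Fin 6 → ℕ := ![0, d₁, 2 * d₁, d₂, d₁ + d₂, 2 * d₂] with hE
  set R : Fin 4 → ℝ := ![r₁, r₂, r₃, r₄] with hR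
  have hEmono : StrictMono E := by
    refine Fin.strictMono_iff_lt_succ.2 fun i => ?_
    fin_cases i <;> simp [hE] <;> omega
  have hRmono : StrictMono R := by
    refine Fin.strictMono_iff_lt_succ.2 fun i => ?_
    fin_cases i <;> simp [hR] <;> linarith
  have hR0 : 0 < R 0 := by simp [hR]; exact h₁
  have hsnoc : ∀ w : ℝ, (Fin.snoc R w : Fin 5 → ℝ) = ![r₁, r₂, r₃, r₄, w] := by
    intro w; ext i; fin_cases i <;> rfl
  set a : Fin 6 → Fin 5 → ℝ := fun j l => (-1) ^ ((3 + 1) + (l : ℕ)) *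
      (Matrix.of fun (i : Fin 4) (m : Fin 4) => R i ^ E (j.succAbove (l.succAbove m))).det with ha
  set P : Fin 6 → ℝ[X] := fun j => ∑ l : Fin 5, C (a j l) * X ^ E (j.succAbove l) with hP
  have hPeval : ∀ j (w : ℝ), (P j).eval w = (Matrix.of fun (i : Fin 5) (l : Fin 5) =>
        (![r₁, r₂, r₃, r₄, w] : Fin 5 → ℝ) i ^ E (j.succAbove l)).det := by
    intro j w
    rw [← hsnoc w, genVandermonde_det_eq_eval R (fun l => E (j.succAbove l)) w]
  have hDP : ∀ j, D j = (P j).eval y := fun j => by rw [hD j, hPeval]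
  have htop : ∀ j, 0 < a j (Fin.last 4) := by
    intro j
    rw [ha]
    simp only [Fin.val_last, Fin.succAbove_last]
    rw [show (3 + 1 + 4 : ℕ) = 2 * 4 by norm_num, pow_mul, neg_one_sq, one_pow, one_mul]
    exact genVandermonde_det_pos 3 R (fun m => E (j.succAbove (Fin.castSucc m))) hRmono hR0
      (hEmono.comp ((Fin.strictMono_succAbove j).comp (Fin.strictMono_castSucc)))
  have hdeglc : ∀ j, (P j).degree = (E (j.succAbove (Fin.last 4)) : WithBot ℕ) ∧ (P j).leadingCoeff = a j (Fin.last 4) := fun j =>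
    natDegree_leadingCoeff_sum_C_mul_X_pow (a j) (fun l => E (j.succAbove l)) (hEmono.comp (Fin.strictMono_succAbove j)) (htop j).ne'
  have hPne : ∀ j, P j ≠ 0 := fun j h => by have := (hdeglc j).2; rw [h, leadingCoeff_zero] at this; exact (htop j).ne' this.symm
  have htopE : ∀ j : Fin 6, E (j.succAbove (Fin.last 4)) = if j = 5 then d₁ + d₂ else 2 * d₂ := by
    intro j; fin_cases j <;> rfl
  have hnat : ∀ j : Fin 6, (P j).natDegree = if j = 5 then d₁ + d₂ else 2 * d₂ := by
    intro j; rw [← htopE j]; exact natDegree_eq_of_degree_eq_some (hdeglc j).1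
  have hlcc : ∀ j : Fin 6, (P j).coeff (P j).natDegree = a j (Fin.last 4) := fun j => (hdeglc j).2
  have hB : ∀ j : Fin 5, a (Fin.castSucc j) (Fin.last 4) = (Matrix.of fun (i : Fin 4) (l : Fin 4) =>
        (![r₁, r₂, r₃, r₄] : Fin 4 → ℝ) i ^ (![0, d₁, 2 * d₁, d₂, d₁ + d₂] : Fin 5 → ℕ) (j.succAbove l)).det := by
    intro j
    rw [ha]
    simp only [Fin.val_last, Fin.succAbove_last]
    rw [show (3 + 1 + 4 : ℕ) = 2 * 4 by norm_num, pow_mul, neg_one_sq, one_pow, one_mul]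
    congr 1
    ext i l
    simp only [Matrix.of_apply]
    congr 1
    fin_cases j <;> fin_cases l <;> rfl
  have hE4 := peel_E4_neg d₁ d₂ hd₁ hw r₁ r₂ r₃ r₄ h₁ h₁₂ h₂₃ h₃₄ (fun j => a (Fin.castSucc j) (Fin.last 4)) hB
  set M : ℝ[X] := -(P 1 * P 3 * P 4 * C (1/4 : ℝ)) + P 0 * P 4 ^ 2 * C (1/4 : ℝ) + P 2 * P 3 ^ 2 * C (1/4 : ℝ) with hM
  set L : ℝ[X] := P 0 * P 2 * P 5 - P 5 * P 1 ^ 2 * C (1/4 : ℝ) with hL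
  set Qp : ℝ[X] := M + L with hQp
  have hQeval : ∀ w, Qp.eval w = (P 0).eval w * (P 2).eval w * (P 5).eval w - (P 1).eval w * (P 3).eval w * (P 4).eval w / 4
      + (P 0).eval w * (P 4).eval w ^ 2 / 4 + (P 2).eval w * (P 3).eval w ^ 2 / 4 - (P 5).eval w * (P 1).eval w ^ 2 / 4 := by
    intro w; simp only [hQp, hM, hL, eval_sub, eval_add, eval_neg, eval_mul, eval_pow, eval_C]; ring
  have hn0 := hnat 0; have hn1 := hnat 1; have hn2 := hnat 2; have hn3 := hnat 3; have hn4 := hnat 4; have hn5 := hnat 5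
  simp only [Fin.reduceEq, if_false, if_true] at hn0 hn1 hn2 hn3 hn4 hn5
  have hc0 : (P 0).coeff (2 * d₂) = a 0 (Fin.last 4) := by rw [← hn0]; exact hlcc 0
  have hc1 : (P 1).coeff (2 * d₂) = a 1 (Fin.last 4) := by rw [← hn1]; exact hlcc 1
  have hc2 : (P 2).coeff (2 * d₂) = a 2 (Fin.last 4) := by rw [← hn2]; exact hlcc 2
  have hc3 : (P 3).coeff (2 * d₂) = a 3 (Fin.last 4) := by rw [← hn3]; exact hlcc 3
  have hc4 : (P 4).coeff (2 * d₂) = a 4 (Fin.last 4) := by rw [← hn4]; exact hlcc 4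
  have hC4 : (C (1/4 : ℝ) : ℝ[X]).natDegree ≤ 0 := (natDegree_C _).le
  have hM_le : M.natDegree ≤ 6 * d₂ := by
    rw [hM]
    refine (natDegree_add_le _ _).trans (max_le ((natDegree_add_le _ _).trans (max_le ?_ ?_)) ?_)
    · rw [natDegree_neg]
      refine natDegree_mul_le.trans ((Nat.add_le_add (natDegree_mul_le.trans (Nat.add_le_add natDegree_mul_le le_rfl)) hC4).trans ?_)
      rw [hn1, hn3, hn4]; omega
    · refine natDegree_mul_le.trans ((Nat.add_le_add (natDegree_mul_le.trans (Nat.add_le_add le_rfl natDegree_pow_le)) hC4).trans ?_)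
      rw [hn0, hn4]; omega
    · refine natDegree_mul_le.trans ((Nat.add_le_add (natDegree_mul_le.trans (Nat.add_le_add le_rfl natDegree_pow_le)) hC4).trans ?_)
      rw [hn2, hn3]; omega
  have hL_lt : L.natDegree < 6 * d₂ := by
    rw [hL]
    refine (natDegree_sub_le _ _).trans_lt (max_lt ?_ ?_)
    · refine natDegree_mul_le.trans_lt ((Nat.add_le_add natDegree_mul_le le_rfl).trans_lt ?_)
      rw [hn0, hn2, hn5]; omega
    · refine natDegree_mul_le.trans_lt ((Nat.add_le_add (natDegree_mul_le.trans (Nat.add_le_add le_rfl natDegree_pow_le)) hC4).trans_lt ?_)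
      rw [hn5, hn1]; omega
  have hsq : ∀ j : Fin 6, (P j).natDegree = 2 * d₂ → (P j ^ 2).coeff (2 * d₂ + 2 * d₂) = (P j).coeff (2 * d₂) ^ 2 := by
    intro j hj; rw [pow_two, pow_two, coeff_mul_top hj.le hj.le]
  have e134 : (P 1 * P 3 * P 4 * C (1/4 : ℝ)).coeff (6 * d₂) = a 1 (Fin.last 4) * a 3 (Fin.last 4) * a 4 (Fin.last 4) * (1/4) := by
    rw [coeff_mul_C, show 6 * d₂ = (2 * d₂ + 2 * d₂) + 2 * d₂ by ring,
      coeff_mul_top (natDegree_mul_le.trans (by rw [hn1, hn3])) hn4.le, coeff_mul_top hn1.le hn3.le, hc1, hc3, hc4]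
  have e044 : (P 0 * P 4 ^ 2 * C (1/4 : ℝ)).coeff (6 * d₂) = a 0 (Fin.last 4) * a 4 (Fin.last 4) ^ 2 * (1/4) := by
    rw [coeff_mul_C, show 6 * d₂ = 2 * d₂ + (2 * d₂ + 2 * d₂) by ring,
      coeff_mul_top hn0.le (natDegree_pow_le.trans (by rw [hn4]; omega)), hsq 4 hn4, hc0, hc4]
  have e233 : (P 2 * P 3 ^ 2 * C (1/4 : ℝ)).coeff (6 * d₂) = a 2 (Fin.last 4) * a 3 (Fin.last 4) ^ 2 * (1/4) := by
    rw [coeff_mul_C, show 6 * d₂ = 2 * d₂ + (2 * d₂ + 2 * d₂) by ring,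
      coeff_mul_top hn2.le (natDegree_pow_le.trans (by rw [hn3]; omega)), hsq 3 hn3, hc2, hc3]
  have hcoefM : M.coeff (6 * d₂) = -(a 1 (Fin.last 4) * a 3 (Fin.last 4) * a 4 (Fin.last 4)
      - a 0 (Fin.last 4) * a 4 (Fin.last 4) ^ 2 - a 2 (Fin.last 4) * a 3 (Fin.last 4) ^ 2) * (1/4 : ℝ) := by
    rw [hM, coeff_add, coeff_add, coeff_neg, e134, e044, e233]; ring
  have hB1 : a 1 (Fin.last 4) = a (Fin.castSucc 1) (Fin.last 4) := rfl
  have hB0 : a 0 (Fin.last 4) = a (Fin.castSucc 0) (Fin.last 4) := rfl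
  have hB2 : a 2 (Fin.last 4) = a (Fin.castSucc 2) (Fin.last 4) := rfl
  have hB3 : a 3 (Fin.last 4) = a (Fin.castSucc 3) (Fin.last 4) := rfl
  have hB4 : a 4 (Fin.last 4) = a (Fin.castSucc 4) (Fin.last 4) := rfl
  have hcoefM_pos : 0 < M.coeff (6 * d₂) := by
    rw [hcoefM, hB0, hB1, hB2, hB3, hB4]
    exact mul_pos (by linarith [hE4]) (by norm_num)
  have hMnat : M.natDegree = 6 * d₂ := natDegree_eq_of_le_of_coeff_ne_zero hM_le hcoefM_pos.ne'
  have hMne : M ≠ 0 := fun h => by rw [h, coeff_zero] at hcoefM_pos; exact lt_irrefl _ hcoefM_pos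
  have hdegLM : L.degree < M.degree := degree_lt_degree (by rw [hMnat]; exact hL_lt)
  have hQlc : Qp.leadingCoeff = M.coeff (6 * d₂) := by
    rw [hQp, leadingCoeff_add_of_degree_lt' hdegLM, leadingCoeff, hMnat]
  have hQdegpos : 0 < Qp.degree := by
    rw [hQp, degree_add_eq_left_of_degree_lt hdegLM, degree_eq_natDegree hMne, hMnat]
    exact_mod_cast (show 0 < 6 * d₂ by omega)
  have hno : ∀ w, r₄ < w → Qp.eval w ≠ 0 := by
    intro w hw0 hQw
    set c : Fin 6 → ℝ := fun j => (-1) ^ ((4 + 1) + (j : ℕ)) * (P j).eval w with hc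
    set G : ℝ[X] := ∑ j : Fin 6, C (c j) * X ^ E j with hG
    have hGeval : ∀ t, G.eval t = (Matrix.of fun (i : Fin 6) (j : Fin 6) =>
        (Fin.snoc (![r₁, r₂, r₃, r₄, w] : Fin 5 → ℝ) t : Fin 6 → ℝ) i ^ E j).det := by
      intro t
      rw [genVandermonde_det_eq_eval (![r₁, r₂, r₃, r₄, w]) E t, hG]
      simp only [hc, hPeval]
    have hGroot : ∀ t, (t = r₁ ∨ t = r₂ ∨ t = r₃ ∨ t = r₄ ∨ t = w) → G.eval t = 0 := by
      intro t ht
      rw [hGeval]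
      rcases ht with rfl | rfl | rfl | rfl | rfl
      · exact Matrix.det_zero_of_row_eq (i := 0) (j := 5) (by decide) (by ext l; simp [Fin.snoc])
      · exact Matrix.det_zero_of_row_eq (i := 1) (j := 5) (by decide) (by ext l; simp [Fin.snoc])
      · exact Matrix.det_zero_of_row_eq (i := 2) (j := 5) (by decide) (by ext l; simp [Fin.snoc])
      · exact Matrix.det_zero_of_row_eq (i := 3) (j := 5) (by decide) (by ext l; simp [Fin.snoc])
      · exact Matrix.det_zero_of_row_eq (i := 4) (j := 5) (by decide) (by ext l; simp [Fin.snoc])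
    have v3 : ((3 : Fin 6) : ℕ) = 3 := rfl
    have v4 : ((4 : Fin 6) : ℕ) = 4 := rfl
    have v5 : ((5 : Fin 6) : ℕ) = 5 := rfl
    have hc5 : c 5 ≠ 0 := by
      rw [hc]
      simp only [v5]
      rw [show (4 + 1 + 5 : ℕ) = 2 * 5 by norm_num, pow_mul, neg_one_sq, one_pow, one_mul, hPeval]
      refine genVandermonde_det_ne_zero _ _ ?_ ?_ (hEmono.comp (Fin.strictMono_succAbove 5)).injective
      · have hm : StrictMono (![r₁, r₂, r₃, r₄, w] : Fin 5 → ℝ) := by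
          refine Fin.strictMono_iff_lt_succ.2 fun i => ?_
          fin_cases i <;> simp <;> linarith
        exact hm.injective
      · intro i; fin_cases i <;> simp <;> linarith
    have hGne : G ≠ 0 := by
      intro h0
      have : G.coeff (E 5) = c 5 := by
        rw [hG, finsetSum_coeff, Finset.sum_eq_single (5 : Fin 6)]
        · rw [coeff_C_mul, coeff_X_pow, if_pos rfl, mul_one]
        · intro j _ hj; rw [coeff_C_mul, coeff_X_pow, if_neg (fun h => hj (hEmono.injective h).symm), mul_zero]
        · intro h; exact absurd (Finset.mem_univ _) h
      rw [h0, coeff_zero] at this; exact hc5 this.symm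
    have hfive : 5 ≤ (G.roots.toFinset.filter (fun t => 0 < t)).card := by
      have hsub : ({r₁, r₂, r₃, r₄, w} : Finset ℝ) ⊆ G.roots.toFinset.filter (fun t => 0 < t) := by
        intro t ht
        simp only [Finset.mem_insert, Finset.mem_singleton] at ht
        rw [Finset.mem_filter, Multiset.mem_toFinset, mem_roots hGne, IsRoot.def]
        refine ⟨hGroot t ht, ?_⟩
        rcases ht with rfl | rfl | rfl | rfl | rfl <;> linarith
      have hcard : ({r₁, r₂, r₃, r₄, w} : Finset ℝ).card = 5 := by
        rw [Finset.card_insert_of_notMem, Finset.card_insert_of_notMem, Finset.card_insert_of_notMem, Finset.card_insert_of_notMem,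
          Finset.card_singleton]
        · simp only [Finset.mem_singleton]; linarith
        · simp only [Finset.mem_insert, Finset.mem_singleton, not_or]; constructor <;> linarith
        · simp only [Finset.mem_insert, Finset.mem_singleton, not_or]; refine ⟨?_, ?_, ?_⟩ <;> linarith
        · simp only [Finset.mem_insert, Finset.mem_singleton, not_or]; refine ⟨?_, ?_, ?_, ?_⟩ <;> linarith
      exact hcard ▸ Finset.card_le_card hsub
    have hgram : (!![c 0, c 1 / 2, c 3 / 2; c 1 / 2, c 2, c 4 / 2; c 3 / 2, c 4 / 2, c 5] : Matrix (Fin 3) (Fin 3) ℝ).det = 0 := by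
      have hq := hQw
      rw [hQeval] at hq
      simp only [Matrix.det_fin_three, Matrix.of_apply, Matrix.cons_val', Matrix.cons_val_zero, Matrix.cons_val_one, Matrix.cons_val_two,
        Matrix.empty_val', Matrix.cons_val_fin_one, Matrix.head_cons, Matrix.tail_cons, Matrix.head_fin_const, hc]
      simp only [Fin.val_zero, Fin.val_one, Fin.val_two, v3, v4, v5]
      norm_num
      linear_combination hq
    have hGform : G = C (c 0) * X ^ 0 + C (c 1) * X ^ d₁ + C (c 2) * X ^ (2 * d₁) + C (c 3) * X ^ d₂ + C (c 4) * X ^ (d₁ + d₂)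
        + C (c 5) * X ^ (2 * d₂) := by
      rw [hG, Fin.sum_univ_six]; simp [hE]
    have hfour := card_posRoots_le_four_of_gram_det_eq_zero d₁ d₂ (c 0) (c 1) (c 2) (c 3) (c 4) (c 5) hgram (by rw [← hGform]; exact hGne)
    rw [← hGform] at hfour
    omega
  have := leadingCoeff_mul_eval_pos_of_no_roots_beyond Qp hQdegpos r₄ hno y h₄
  rw [hQlc, hQeval] at this
  simp only [hDP]
  exact pos_of_mul_pos_right this hcoefM_pos.le

end Summit.ValiantsHypothesis.ValiantsHypothesis.Theorems.LacunarySymmetroidMatrixDescartes.Census
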